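import Summits.ResolutionOfSingularities.ResolutionOfSingularities.Theorems.EquisingularLiftEquisingularLiftNatNoLevel
import HarnessLib

/-!
# [OURS] NO LEVEL PROPAGATES DOWN THE TOWER: if the translate of a strict transform at a mark has NO blow-up depth, neither has the origin — and the
# `E₁₂`-type point `x² + y³ + z⁷` has NO finite blow-up depth in any blow-up tower (every field)
# (cruxes `Theses.EquisingularLift.EquisingularLiftNat` / `…NatThree` / `EquisingularLift`, stmt-ResolutionOfSingularities-20038 / -20148 / -15660)

[OURS · leafhand-res-equisingularlift-12 g1, 2026-09-01; cell `pub/decomp-res`] AI-produced, weaker than expert review; NOT a statement of any manuscript;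
nothing here proves resolution of singularities in positive characteristic.  DEF-FREE helper; no `sorry`; standard axioms; ZERO named hypotheses.

The mirror image of ✓ `OneStep.towerLevel_succ_origin_marked` (levels go UP the tower from the translates at the marks): if chart `a` of the blow-up of the
origin of `Spec K[y]/(Φ + Ψ)` carries a strict transform `G` with `G ∈ 𝔪_λ²` at a mark `λ` with `λ_a = 0` (a singular point ON the exceptional divisor) and
the translate `H = G(T + λ)` has NO `D`-level at its origin, then the origin of `Spec K[y]/(Φ + Ψ)` has no `D`-level: at level `0` the point `φ(χ(𝔪̄_λ))`
of the model blow-up is non-regular over the origin; at level `d + 1` it would carry some level `≤ d`, transported (✓ `tower_loc`) along the chart open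
immersion and `Spec` of `K[T]/(H) ≅ K[T]/(G) ≅` chart ring to the origin of `Spec K[T]/(H)`.

* ★★★ `OneStep.towerLevel_none_origin_of_mark` — the propagation theorem;
* ★★★ `OneStep.towerLevel_none_origin_E12` — `x² + y³ + z⁷` (`y₂² + y₀³ + y₁⁷`, the `E₁₂`-type isolated double point; every field): chart `1` carries
  `T₂² + T₀³T₁ + T₁⁵` at its origin, which has no level by ✓ `towerLevel_none_origin_E12blowup`; hence NO `D`-level for any blow-up tower `D`.

Honest consequence: `x² + y³ + z⁷`-type points are outside every finite-depth class of the depth programme (the isolated residual of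
`stub_elnat_three_isolated…` is not exhausted by `IsoHypPoint`-via-towers).  Closes no registered stub.

References: [StacksProject, Tags 0804, 080E]; [Matsumura1987, Thm. 14.2]; [Hartshorne1977, II Ex. 7.12]; through the cited tree files.
-/

set_option linter.dupNamespace false -- mandated namespace `Summit.<Summit>.<Problem>` of this single-conjunct summit

noncomputable section

open CategoryTheory CategoryTheory.Limits AlgebraicGeometry TopologicalSpace Topology
open MvPolynomial
open Literature.AlgebraicGeometry.Resolution
open AlgebraicGeometry.Scheme.IdealSheafData
open Summit.ResolutionOfSingularities.ResolutionOfSingularities.Cruxes.EquisingularLiftNat.Sections.ND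

namespace Summit.ResolutionOfSingularities.ResolutionOfSingularities.Cruxes.EquisingularLiftNat.Sections

namespace OneStep

variable (K : Type) [Field K] {N : ℕ}

set_option maxHeartbeats 1600000 in -- the chart algebra `blowupAlgebra` is a subalgebra of a localisation: slow instance unification (as in …NatMarkedTower)
/-- ★★★ **NO LEVEL AT A MARK'S TRANSLATE ⟹ NO LEVEL AT THE ORIGIN.** [OURS] [cite: StacksProject, Tags 0804, 080E] [cite: Matsumura1987, Thm. 14.2] -/
theorem towerLevel_none_origin_of_mark (D : ℕ → ∀ Γ : Scheme.{0}, Γ → Prop)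
    (hD0 : ∀ (Γ : Scheme.{0}) (y : Γ), IsClosed (({y} : Set Γ)) →
      (D 0 Γ y ↔ ∀ (hy : IsClosed (({y} : Set Γ))) (Z : Scheme.{0}) (τ : Z ⟶ Γ), IsBlowup τ (vanishingIdeal ⟨{y}, hy⟩) →
        ∀ z : Z, τ z = y → IsRegularLocalRing (Z.presheaf.stalk z)))
    (hDsucc : ∀ (d : ℕ) (Γ : Scheme.{0}) (y : Γ), IsClosed (({y} : Set Γ)) →
      (D (d + 1) Γ y ↔ ∀ (hy : IsClosed (({y} : Set Γ))) (Z : Scheme.{0}) (τ : Z ⟶ Γ), IsBlowup τ (vanishingIdeal ⟨{y}, hy⟩) →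
        ∃ S' : Finset Z, (∀ z : Z, τ z = y → z ∉ S' → IsRegularLocalRing (Z.presheaf.stalk z)) ∧
          ∀ z ∈ S', τ z = y ∧ IsClosed (({z} : Set Z)) ∧ ∃ d' ≤ d, D d' Z z))
    (Φ Ψ : MvPolynomial (Fin (N + 1)) K) {μ : ℕ} (hμ : 1 ≤ μ) (hΦ : Φ.IsHomogeneous μ) (hΦ0 : Φ ≠ 0)
    (hΨ : Ψ ∈ Ideal.span (Set.range (X : Fin (N + 1) → MvPolynomial (Fin (N + 1)) K)) ^ (μ + 1))
    (a : Fin (N + 1)) (G : MvPolynomial (Fin (N + 1)) K) (hG0 : G ≠ 0)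
    (hG : aeval (fun j => X a * Function.update (X : Fin (N + 1) → MvPolynomial (Fin (N + 1)) K) a 1 j) (Φ + Ψ) = X a ^ μ * G)
    (lam : Fin (N + 1) → K)
    (hlama : (X a : MvPolynomial (Fin (N + 1)) K) ∈ Ideal.span (Set.range fun i : Fin (N + 1) => (X i - C (lam i) : MvPolynomial (Fin (N + 1)) K)))
    (hG2 : G ∈ Ideal.span (Set.range fun i : Fin (N + 1) => (X i - C (lam i) : MvPolynomial (Fin (N + 1)) K)) ^ 2)
    (H : MvPolynomial (Fin (N + 1)) K) (hGH : aeval (fun i => X i + C (lam i)) G = H)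
    (hnone : ∀ y' : Spec (CommRingCat.of (MvPolynomial (Fin (N + 1)) K ⧸ Ideal.span {H})),
      y'.asIdeal = Ideal.map (Ideal.Quotient.mk (Ideal.span {H})) (Ideal.span (Set.range (X : Fin (N + 1) → MvPolynomial (Fin (N + 1)) K))) →
      ∀ m, ¬ D m (Spec (CommRingCat.of (MvPolynomial (Fin (N + 1)) K ⧸ Ideal.span {H}))) y')
    (y₀ : Spec (CommRingCat.of (MvPolynomial (Fin (N + 1)) K ⧸ Ideal.span {Φ + Ψ})))
    (hy₀ : y₀.asIdeal = Ideal.map (Ideal.Quotient.mk (Ideal.span {Φ + Ψ}))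
      (Ideal.span (Set.range (X : Fin (N + 1) → MvPolynomial (Fin (N + 1)) K)))) (n : ℕ) :
    ¬ D n (Spec (CommRingCat.of (MvPolynomial (Fin (N + 1)) K ⧸ Ideal.span {Φ + Ψ}))) y₀ := by
  classical
  -- the origin is a closed point; the model blow-up
  have hmax := isMaximal_map_mk_span_range_X K Φ Ψ hμ hΦ hΨ
  have hy : IsClosed ({y₀} : Set (Spec (CommRingCat.of (MvPolynomial (Fin (N + 1)) K ⧸ Ideal.span {Φ + Ψ})))) :=
    (PrimeSpectrum.isClosed_singleton_iff_isMaximal y₀).mpr (hy₀ ▸ hmax)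
  let τ₀ := blowup.π (vanishingIdeal (⟨{y₀}, hy⟩ : Closeds (Spec (CommRingCat.of (MvPolynomial (Fin (N + 1)) K ⧸ Ideal.span {Φ + Ψ})))))
  have hτ₀ : IsBlowup τ₀ (vanishingIdeal ⟨{y₀}, hy⟩) := blowup.isBlowup _
  have hrad : (Ideal.map (Ideal.Quotient.mk (Ideal.span {Φ + Ψ}))
      (Ideal.span (Set.range (X : Fin (N + 1) → MvPolynomial (Fin (N + 1)) K)))).IsRadical := hmax.isPrime.isRadical
  have hsing : ({y₀} : Set (Spec (CommRingCat.of (MvPolynomial (Fin (N + 1)) K ⧸ Ideal.span {Φ + Ψ})))) =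
      PrimeSpectrum.zeroLocus ((Ideal.map (Ideal.Quotient.mk (Ideal.span {Φ + Ψ}))
        (Ideal.span (Set.range (X : Fin (N + 1) → MvPolynomial (Fin (N + 1)) K))) : Set _)) := by
    rw [← hy₀]
    exact singleton_eq_zeroLocus_of_isMaximal y₀ (hy₀ ▸ hmax)
  have hC : (⟨{y₀}, hy⟩ : Closeds (Spec (CommRingCat.of (MvPolynomial (Fin (N + 1)) K ⧸ Ideal.span {Φ + Ψ})))) =
      ⟨PrimeSpectrum.zeroLocus ((Ideal.map (Ideal.Quotient.mk (Ideal.span {Φ + Ψ}))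
        (Ideal.span (Set.range (X : Fin (N + 1) → MvPolynomial (Fin (N + 1)) K))) : Set _)), PrimeSpectrum.isClosed_zeroLocus _⟩ :=
    Closeds.ext hsing
  have hV : vanishingIdeal (⟨{y₀}, hy⟩ : Closeds (Spec (CommRingCat.of (MvPolynomial (Fin (N + 1)) K ⧸ Ideal.span {Φ + Ψ})))) = (ofIdealTop (Ideal.map (Scheme.ΓSpecIso (CommRingCat.of (MvPolynomial (Fin (N + 1)) K ⧸ Ideal.span {Φ + Ψ}))).inv.hom (Ideal.map (Ideal.Quotient.mk (Ideal.span {Φ + Ψ})) (Ideal.span (Set.range (X : Fin (N + 1) → MvPolynomial (Fin (N + 1)) K)))))) := by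
    rw [hC]
    exact vanishingIdeal_zeroLocus_eq_ofIdealTop_of_isRadical _ hrad
  have hτ₀' : IsBlowup τ₀ (ofIdealTop (Ideal.map (Scheme.ΓSpecIso (CommRingCat.of (MvPolynomial (Fin (N + 1)) K ⧸ Ideal.span {Φ + Ψ}))).inv.hom (Ideal.map (Ideal.Quotient.mk (Ideal.span {Φ + Ψ})) (Ideal.span (Set.range (X : Fin (N + 1) → MvPolynomial (Fin (N + 1)) K)))))) := by
    rw [← hV]; exact hτ₀
  -- the chart `a`
  let g : Fin (N + 1) → (MvPolynomial (Fin (N + 1)) K ⧸ Ideal.span {Φ + Ψ}) := fun i => Ideal.Quotient.mk (Ideal.span {Φ + Ψ}) (X i)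
  have hg : Ideal.span (Set.range g) =
      Ideal.map (Ideal.Quotient.mk (Ideal.span {Φ + Ψ})) (Ideal.span (Set.range (X : Fin (N + 1) → MvPolynomial (Fin (N + 1)) K))) := by
    rw [Ideal.map_span, ← Set.range_comp]
    rfl
  obtain ⟨φ, hφ, hφρ⟩ := exists_chart_index (A := CommRingCat.of (MvPolynomial (Fin (N + 1)) K ⧸ Ideal.span {Φ + Ψ})) hτ₀' g hg a
  haveI := hφ
  obtain ⟨χ, hχa, -⟩ := exists_chartEquiv_prime K Φ Ψ hΦ hΦ0 hΨ a G hG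
  haveI : IsProper τ₀ := hτ₀.isProper
  have hloc := tower_loc D hD0 hDsucc
  -- the mark `𝔪 = (T - λ)`, `P̄ = 𝔪/(G)`, the point `w = χ(P̄)`
  let 𝔪 : Ideal (MvPolynomial (Fin (N + 1)) K) := Ideal.span (Set.range fun i : Fin (N + 1) => (X i - C (lam i) : MvPolynomial (Fin (N + 1)) K))
  have h𝔪 : 𝔪.IsMaximal := isMaximal_span_range_X_sub_C K lam
  have hker : RingHom.ker (Ideal.Quotient.mk (Ideal.span {G})) ≤ 𝔪 := by
    rw [Ideal.mk_ker]
    exact (Ideal.span_singleton_le_iff_mem _).mpr (Ideal.pow_le_self two_ne_zero hG2)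
  let Pb : Ideal (MvPolynomial (Fin (N + 1)) K ⧸ Ideal.span {G}) := 𝔪.map (Ideal.Quotient.mk (Ideal.span {G}))
  haveI hPb : Pb.IsPrime := Ideal.map_isPrime_of_surjective Ideal.Quotient.mk_surjective hker
  have hcomapP : Pb.comap (Ideal.Quotient.mk (Ideal.span {G})) = 𝔪 := by
    rw [Ideal.comap_map_of_surjective _ Ideal.Quotient.mk_surjective, sup_eq_left, ← RingHom.ker_eq_comap_bot]
    exact hker
  let 𝔑 := Pb.map χ.toRingHom
  have h𝔑 : 𝔑 = Pb.comap χ.symm.toRingHom := Ideal.map_comap_of_equiv (χ : _ ≃+* _)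
  haveI : 𝔑.IsPrime := by rw [h𝔑]; exact Ideal.comap_isPrime _ _
  let w : Spec (CommRingCat.of (blowupAlgebra ((Ideal.span (Set.range (X : Fin (N + 1) → MvPolynomial (Fin (N + 1)) K))).map
      (Ideal.Quotient.mk (Ideal.span {Φ + Ψ}))) (Ideal.Quotient.mk (Ideal.span {Φ + Ψ}) (X a)))) := ⟨𝔑, inferInstance⟩
  have hw : w.asIdeal = Ideal.map χ.toRingHom (Ideal.map (Ideal.Quotient.mk (Ideal.span {G}))
      (Ideal.span (Set.range fun i : Fin (N + 1) => (X i - C (lam i) : MvPolynomial (Fin (N + 1)) K)))) := rfl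
  have hmem𝔑 : ∀ x, x ∈ 𝔑 ↔ χ.symm x ∈ Pb := fun x => by rw [h𝔑, Ideal.mem_comap]; rfl
  have hya𝔑 : algebraMap (MvPolynomial (Fin (N + 1)) K ⧸ Ideal.span {Φ + Ψ}) _ (Ideal.Quotient.mk (Ideal.span {Φ + Ψ}) (X a)) ∈ 𝔑 := by
    rw [← hχa]
    exact Ideal.mem_map_of_mem _ (Ideal.mem_map_of_mem _ hlama)
  have hover : τ₀ (φ w) = y₀ := by
    have h1 : τ₀ (φ w) = (φ ≫ τ₀) w := rfl
    rw [h1, hφρ]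
    apply PrimeSpectrum.ext
    rw [hy₀]
    change Ideal.comap (algebraMap (MvPolynomial (Fin (N + 1)) K ⧸ Ideal.span {Φ + Ψ}) _) 𝔑 = _
    refine (hmax.eq_of_le (Ideal.IsPrime.ne_top (Ideal.comap_isPrime _ 𝔑)) ?_).symm
    refine Ideal.map_le_iff_le_comap.mpr (Ideal.span_le.mpr (Set.range_subset_iff.mpr fun i => ?_))
    rw [SetLike.mem_coe, Ideal.mem_comap, Ideal.mem_comap]
    have hi : Ideal.Quotient.mk (Ideal.span {Φ + Ψ}) (X i) ∈ (Ideal.span (Set.range (X : Fin (N + 1) → MvPolynomial (Fin (N + 1)) K))).map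
        (Ideal.Quotient.mk (Ideal.span {Φ + Ψ})) := Ideal.mem_map_of_mem _ (Ideal.subset_span (Set.mem_range_self i))
    rw [← blowupAlgebra.algebraMap_mul_gen _ _ _ hi]
    exact Ideal.mul_mem_right _ _ hya𝔑
  have hnreg_loc : ¬ IsRegularLocalRing (Localization.AtPrime 𝔑) := by
    intro hreg
    have hPbreg : IsRegularLocalRing (Localization.AtPrime Pb) :=
      OrdPoint.isRegularLocalRing_localization_of_ringEquiv χ.symm 𝔑 Pb (fun x => (hmem𝔑 x).symm) hreg
    exact not_isRegularLocalRing_localization_quotient_of_mem_sq (C := MvPolynomial (Fin (N + 1)) K) hG0 Pb (by rw [hcomapP]; exact hG2) hPbreg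
  have hnreg : ¬ IsRegularLocalRing ((blowup (vanishingIdeal (⟨{y₀}, hy⟩ : Closeds (Spec (CommRingCat.of (MvPolynomial (Fin (N + 1)) K ⧸ Ideal.span {Φ + Ψ})))))).presheaf.stalk (φ w)) :=
    fun h => hnreg_loc ((isRegularLocalRing_stalk_Spec_iff _ w).mp ((isRegularLocalRing_stalk_iff_of_isOpenImmersion φ w).mp h))
  -- the translate: `K[T]/(H) ≅ K[T]/(G) ≅ chart ring`, and closedness of `w`, `φ w`
  obtain ⟨σ, hσ⟩ := exists_translate_quotientEquiv K lam G H hGH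
  have hw' : w.asIdeal = Ideal.map (σ.trans χ).toRingHom (Ideal.map (Ideal.Quotient.mk (Ideal.span {H}))
      (Ideal.span (Set.range (X : Fin (N + 1) → MvPolynomial (Fin (N + 1)) K)))) := by
    rw [hw, ← hσ, Ideal.map_map]
    rfl
  obtain ⟨hwcl, hzcl⟩ := isClosed_singleton_chartOrigin K Φ Ψ a H (σ.trans χ) τ₀ φ w hw'
  -- the origin of `Spec K[T]/(H)` is a closed point
  have hmax' : (Ideal.map (Ideal.Quotient.mk (Ideal.span {H}))
      (Ideal.span (Set.range (X : Fin (N + 1) → MvPolynomial (Fin (N + 1)) K)))).IsMaximal := by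
    rcases Ideal.map_eq_top_or_isMaximal_of_surjective (Ideal.Quotient.mk (Ideal.span {H})) Ideal.Quotient.mk_surjective
      (isMaximal_span_range_X' K (N := N)) with h | h
    · exfalso
      apply w.isPrime.ne_top
      rw [hw', h, Ideal.map_top]
    · exact h
  let y₀' : Spec (CommRingCat.of (MvPolynomial (Fin (N + 1)) K ⧸ Ideal.span {H})) :=
    ⟨Ideal.map (Ideal.Quotient.mk (Ideal.span {H})) (Ideal.span (Set.range (X : Fin (N + 1) → MvPolynomial (Fin (N + 1)) K))),
      hmax'.isPrime⟩
  have hy₀' : y₀'.asIdeal = Ideal.map (Ideal.Quotient.mk (Ideal.span {H}))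
      (Ideal.span (Set.range (X : Fin (N + 1) → MvPolynomial (Fin (N + 1)) K))) := rfl
  have hy₀'cl : IsClosed ({y₀'} : Set _) := (PrimeSpectrum.isClosed_singleton_iff_isMaximal y₀').mpr hmax'
  -- no level
  cases n with
  | zero =>
    intro hDn
    exact hnreg ((hD0 _ y₀ hy).mp hDn hy _ τ₀ hτ₀ (φ w) hover)
  | succ d =>
    intro hDn
    obtain ⟨S', hS'reg, hS'⟩ := (hDsucc d _ y₀ hy).mp hDn hy _ τ₀ hτ₀
    by_cases hmemS : φ w ∈ S'
    · obtain ⟨-, -, d', -, hDφw⟩ := hS' _ hmemS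
      -- transport `D d'` from `φ w` back to the origin of `Spec K[T]/(H)`
      let e₁ : Spec (CommRingCat.of (MvPolynomial (Fin (N + 1)) K ⧸ Ideal.span {H})) ≅ Spec (CommRingCat.of (blowupAlgebra ((Ideal.span (Set.range (X : Fin (N + 1) → MvPolynomial (Fin (N + 1)) K))).map
            (Ideal.Quotient.mk (Ideal.span {Φ + Ψ}))) (Ideal.Quotient.mk (Ideal.span {Φ + Ψ}) (X a)))) :=
        Scheme.Spec.mapIso ((σ.trans χ).symm.toCommRingCatIso).op
      have he₁ : e₁.hom y₀' = w := by
        apply PrimeSpectrum.ext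
        rw [hw']
        change Ideal.comap (σ.trans χ).symm.toRingHom y₀'.asIdeal = _
        rw [hy₀']
        exact Ideal.comap_symm (σ.trans χ)
      have he₁' : e₁.inv w = y₀' := by
        rw [← he₁]
        change (e₁.hom ≫ e₁.inv) y₀' = y₀'
        rw [e₁.hom_inv_id]
        rfl
      haveI : IsIso (e₁.inv ∣_ (⊤ : (Spec (CommRingCat.of (MvPolynomial (Fin (N + 1)) K ⧸ Ideal.span {H}))).Opens)) := inferInstance
      let U : (blowup (vanishingIdeal (⟨{y₀}, hy⟩ : Closeds (Spec (CommRingCat.of (MvPolynomial (Fin (N + 1)) K ⧸ Ideal.span {Φ + Ψ})))))).Opens :=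
        φ.opensRange
      let e₂ := φ.isoOpensRange
      have hφU : ∀ v, U.ι (e₂.hom v) = φ v := fun v => by
        rw [← Scheme.Hom.comp_apply, Scheme.Hom.isoOpensRange_hom_ι]
      have hzU : φ w ∈ U := ⟨w, rfl⟩
      have hu₀cl : IsClosed ({e₂.hom w} : Set (U : Scheme.{0})) :=
        PointChain.isClosed_singleton_of_injective U.ι U.ι.isOpenEmbedding.injective (by rw [hφU]; exact hzcl)
      have he₂' : e₂.inv (e₂.hom w) = w := by
        change (e₂.hom ≫ e₂.inv) w = w
        rw [e₂.hom_inv_id]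
        rfl
      haveI : IsIso (e₂.inv ∣_ (⊤ : (Spec (CommRingCat.of (blowupAlgebra ((Ideal.span (Set.range (X : Fin (N + 1) → MvPolynomial (Fin (N + 1)) K))).map
            (Ideal.Quotient.mk (Ideal.span {Φ + Ψ}))) (Ideal.Quotient.mk (Ideal.span {Φ + Ψ}) (X a))))).Opens)) := inferInstance
      haveI := PointChain.isIso_ι_morphismRestrict_self U
      have hDu : D d' (U : Scheme.{0}) (e₂.hom w) :=
        (hloc d' _ _ U.ι U inferInstance (φ w) hzU hzcl (e₂.hom w) (hφU w) hu₀cl).mp hDφw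
      have hDw : D d' (Spec (CommRingCat.of (blowupAlgebra ((Ideal.span (Set.range (X : Fin (N + 1) → MvPolynomial (Fin (N + 1)) K))).map
            (Ideal.Quotient.mk (Ideal.span {Φ + Ψ}))) (Ideal.Quotient.mk (Ideal.span {Φ + Ψ}) (X a))))) w :=
        (hloc d' _ _ e₂.inv ⊤ inferInstance w (Set.mem_univ _) hwcl (e₂.hom w) he₂' hu₀cl).mpr hDu
      have hD' : D d' (Spec (CommRingCat.of (MvPolynomial (Fin (N + 1)) K ⧸ Ideal.span {H}))) y₀' :=
        (hloc d' _ _ e₁.inv ⊤ inferInstance y₀' (Set.mem_univ _) hy₀'cl w he₁' hwcl).mpr hDw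
      exact hnone y₀' hy₀' d' hD'
    · exact hnreg (hS'reg _ hover hmemS)

/-- **Chart `1` of `x² + y³ + z⁷`** (`x := y₂`, `y := y₀`, `z := y₁`): `f(T₁T₀, T₁, T₁T₂) = T₁²·(T₂² + (T₀³T₁ + T₁⁵))` — the point `x² + y³z + z⁵` of
✓ `towerLevel_none_origin_E12blowup` at the origin. [cite: Hartshorne1977, II Ex. 7.12] -/
theorem E12_strictTransform₁ :
    aeval (fun j => X 1 * Function.update (X : Fin 3 → MvPolynomial (Fin 3) K) 1 1 j)
        (X 2 ^ 2 + (X 0 ^ 3 + X 1 ^ 7) : MvPolynomial (Fin 3) K) = X 1 ^ 2 * (X 2 ^ 2 + (X 0 ^ 3 * X 1 + X 1 ^ 5)) := by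
  simp only [map_add, map_pow, aeval_X, Function.update_self, Function.update_of_ne (by decide : (0 : Fin 3) ≠ 1),
    Function.update_of_ne (by decide : (2 : Fin 3) ≠ 1)]
  ring

/-- ★★★ **THE `E₁₂`-TYPE POINT `x² + y³ + z⁷` HAS NO BLOW-UP DEPTH** (every field, every blow-up tower): for every `f = y₀³ + y₁⁷ + y₂²`, the origin of
`Spec K[y]/(f)` has no `D`-level. [OURS] [cite: StacksProject, Tags 0804, 080E] [cite: Matsumura1987, Thm. 14.2] -/
theorem towerLevel_none_origin_E12 (D : ℕ → ∀ Γ : Scheme.{0}, Γ → Prop)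
    (hD0 : ∀ (Γ : Scheme.{0}) (y : Γ), IsClosed (({y} : Set Γ)) →
      (D 0 Γ y ↔ ∀ (hy : IsClosed (({y} : Set Γ))) (Z : Scheme.{0}) (τ : Z ⟶ Γ), IsBlowup τ (vanishingIdeal ⟨{y}, hy⟩) →
        ∀ z : Z, τ z = y → IsRegularLocalRing (Z.presheaf.stalk z)))
    (hDsucc : ∀ (d : ℕ) (Γ : Scheme.{0}) (y : Γ), IsClosed (({y} : Set Γ)) →
      (D (d + 1) Γ y ↔ ∀ (hy : IsClosed (({y} : Set Γ))) (Z : Scheme.{0}) (τ : Z ⟶ Γ), IsBlowup τ (vanishingIdeal ⟨{y}, hy⟩) →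
        ∃ S' : Finset Z, (∀ z : Z, τ z = y → z ∉ S' → IsRegularLocalRing (Z.presheaf.stalk z)) ∧
          ∀ z ∈ S', τ z = y ∧ IsClosed (({z} : Set Z)) ∧ ∃ d' ≤ d, D d' Z z)) :
    ∀ (f : MvPolynomial (Fin 3) K), f = X 0 ^ 3 + X 1 ^ 7 + X 2 ^ 2 →
      ∀ (y₀ : Spec (CommRingCat.of (MvPolynomial (Fin 3) K ⧸ Ideal.span {f}))),
        y₀.asIdeal = Ideal.map (Ideal.Quotient.mk (Ideal.span {f})) (Ideal.span (Set.range (X : Fin 3 → MvPolynomial (Fin 3) K))) →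
        ∀ n, ¬ D n (Spec (CommRingCat.of (MvPolynomial (Fin 3) K ⧸ Ideal.span {f}))) y₀ := by
  classical
  intro f hf y₀ hy₀ n
  have e : (X 2 ^ 2 : MvPolynomial (Fin 3) K) + (X 0 ^ 3 + X 1 ^ 7) = f := by rw [hf]; ring
  subst e
  have hΦ : (X 2 ^ 2 : MvPolynomial (Fin 3) K).IsHomogeneous 2 := isHomogeneous_X_pow (2 : Fin 3) 2
  have hΦ0 : (X 2 ^ 2 : MvPolynomial (Fin 3) K) ≠ 0 := pow_ne_zero _ (X_ne_zero 2)
  have hΨ : (X 0 ^ 3 + X 1 ^ 7 : MvPolynomial (Fin 3) K) ∈ Ideal.span (Set.range (X : Fin 3 → MvPolynomial (Fin 3) K)) ^ (2 + 1) := by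
    refine Ideal.add_mem _ ?_ ?_
    · simpa using SecondOrderPoint.monomial_mem_pow₃ K 3 0 0 (k := 2 + 1) (by norm_num)
    · simpa using SecondOrderPoint.monomial_mem_pow₃ K 0 7 0 (k := 2 + 1) (by norm_num)
  -- the mark `λ = 0` of chart `1`
  let 𝔪 : Ideal (MvPolynomial (Fin 3) K) := Ideal.span (Set.range fun i : Fin 3 => (X i - C ((0 : Fin 3 → K) i) : MvPolynomial (Fin 3) K))
  have hX : ∀ i : Fin 3, (X i : MvPolynomial (Fin 3) K) ∈ 𝔪 := fun i => by
    have h : (X i - C ((0 : Fin 3 → K) i) : MvPolynomial (Fin 3) K) ∈ 𝔪 := Ideal.subset_span ⟨i, rfl⟩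
    simpa using h
  have hG2 : (X 2 ^ 2 + (X 0 ^ 3 * X 1 + X 1 ^ 5) : MvPolynomial (Fin 3) K) ∈ 𝔪 ^ 2 := by
    refine Ideal.add_mem _ (Ideal.pow_mem_pow (hX 2) 2) (Ideal.add_mem _ ?_ ?_)
    · rw [pow_two]
      exact Ideal.mul_mem_mul (Ideal.mul_mem_left _ _ (hX 0)) (hX 1)
    · exact Ideal.pow_le_pow_right (by norm_num : 2 ≤ 5) (Ideal.pow_mem_pow (hX 1) 5)
  have hG0 : (X 2 ^ 2 + (X 0 ^ 3 * X 1 + X 1 ^ 5) : MvPolynomial (Fin 3) K) ≠ 0 := by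
    intro h
    have h1 := congrArg (eval (Pi.single (2 : Fin 3) (1 : K))) h
    simp at h1
  have hGH : aeval (fun i : Fin 3 => X i + C ((0 : Fin 3 → K) i)) (X 2 ^ 2 + (X 0 ^ 3 * X 1 + X 1 ^ 5) : MvPolynomial (Fin 3) K) =
      X 2 ^ 2 + (X 0 ^ 3 * X 1 + X 1 ^ 5) := SecondOrderPoint.aeval_translate_zero K _
  exact towerLevel_none_origin_of_mark K D hD0 hDsucc (X 2 ^ 2) (X 0 ^ 3 + X 1 ^ 7) (by norm_num) hΦ hΦ0 hΨ 1 _ hG0 (E12_strictTransform₁ K)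
    0 (hX 1) hG2 _ hGH (fun y' hy' m => towerLevel_none_origin_E12blowup K D hD0 hDsucc _ (by ring) y' hy' m) y₀ hy₀ n

end OneStep

end Summit.ResolutionOfSingularities.ResolutionOfSingularities.Cruxes.EquisingularLiftNat.Sections

end
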